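import Summits.QuantumAdvantage.AdviceFreeQNC0.RingFlipMap
import HarnessLib

/-!
# Cell qa-qnc0 — sizes of the six monodromy classes; the flip map fails on `(2ⁿ + 2(−1)ⁿ)/6` patterns

The `S₃`-valued monodromy statistic `(reflBit x, sigmaSum x)` (`RingKernel`) splits `{0,1}ⁿ`
into six classes. Prepending a letter acts on the statistic by a fixed rule, so the class sizes
satisfy a linear recurrence (`classCard_succ`); solving it (`six_mul_classCard`, all `n ≥ 1`):

  `6·|{x : reflBit x = rb, sigmaSum x = S}| = 2ⁿ + 2(−1)ⁿ` for `S ∈ {0, 2}`,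
  `= 2ⁿ − 4(−1)ⁿ` for `S = 1` (independently of `rb`).

Consequently (`six_mul_card_zFlip_fail`) the affine strategy `zFlip` of `RingFlipMap.lean` fails
on exactly `(2ⁿ + 2(−1)ⁿ)/6` of the `2ⁿ` patterns, for every `n ≥ 3`: failure probability
`1/6 + (−1)ⁿ/(3·2ⁿ)` — the all-`n` form of the `≈ 1/6` degree-1 value observed by planner
qa-qnc0-p2 (kit j241061/j241418).

WHAT THIS IS NOT: no optimality claim (that NO affine map beats this is p2's `ε₁` data, unproved).
-/

namespace Summit.QuantumAdvantage.AdviceFreeQNC0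

open Finset Literature.Computability.QuantumComplexity Literature.Computability.QuantumComplexity.RingHLF

/-- The size of the monodromy class `(rb, S)` among words of length `n`. -/
def classCard (n : ℕ) (rb : Bool) (S : ZMod 3) : ℕ :=
  (univ.filter fun x : Fin n → Bool => reflBit (List.ofFn x) = rb ∧ sigmaSum (List.ofFn x) = S).card

/-- The correction term: `2(−1)ⁿ` for `S ∈ {0,2}`, `−4(−1)ⁿ` for `S = 1`. -/
def classCorr (n : ℕ) (S : ZMod 3) : ℤ := if S = 1 then -4 * (-1) ^ n else 2 * (-1) ^ n

/-- The sign `(−1)^{rb}` by which a prepended letter moves `sigmaSum`. -/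
def sgn3 (rb : Bool) : ZMod 3 := if rb then -1 else 1

/-- Bookkeeping in `ℤ/3`: `a + (−1) = S ↔ a = S + 1`. -/
private theorem add_neg_one_eq_iff (a S : ZMod 3) : a + -1 = S ↔ a = S + 1 := by
  constructor <;> intro h <;> linear_combination h

/-- **Recurrence**: a word of length `n+1` is a letter `b` prepended to a word `y` of length `n`,
and `(reflBit, sigmaSum)(b :: y) = (reflBit y ⊕ ¬b, sigmaSum y + (−1)^{reflBit y})`; for each
`b` exactly one class of `y` contributes. -/
theorem classCard_succ (n : ℕ) (rb : Bool) (S : ZMod 3) :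
    classCard (n + 1) rb S =
      classCard n rb (S - sgn3 rb) + classCard n (!rb) (S - sgn3 (!rb)) := by
  unfold classCard
  -- pass to sums of indicators and split off the first letter
  rw [card_filter, card_filter, card_filter]
  rw [← Fintype.sum_equiv (Fin.consEquiv fun _ => Bool)
    (fun p : Bool × (Fin n → Bool) =>
      if (reflBit (List.ofFn (Fin.cons p.1 p.2 : Fin (n + 1) → Bool)) = rb ∧
        sigmaSum (List.ofFn (Fin.cons p.1 p.2 : Fin (n + 1) → Bool)) = S) then 1 else 0)
    _ (fun p => rfl)]
  rw [Fintype.sum_prod_type]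
  simp only [Fintype.sum_bool, List.ofFn_cons, reflBit, sigmaSum, Bool.not_true, Bool.xor_false,
    Bool.not_false, Bool.xor_true]
  -- match the two summands
  congr 1
  · refine sum_congr rfl fun y _ => ?_
    unfold sgn3
    cases reflBit (List.ofFn y) <;> cases rb <;> simp [eq_sub_iff_add_eq, add_neg_one_eq_iff]
  · refine sum_congr rfl fun y _ => ?_
    unfold sgn3
    cases reflBit (List.ofFn y) <;> cases rb <;> simp [eq_sub_iff_add_eq, add_neg_one_eq_iff]

/-- Words of length `0`: only the empty word, in class `(false, 0)`. -/
theorem classCard_zero (rb : Bool) (S : ZMod 3) :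
    classCard 0 rb S = if (rb = false ∧ S = 0) then 1 else 0 := by
  unfold classCard
  rw [card_filter]
  simp [reflBit, sigmaSum, eq_comm]

/-- Words of length `1`: `[0] ↦ (true, 1)`, `[1] ↦ (false, 1)`. -/
theorem classCard_one (rb : Bool) (S : ZMod 3) : classCard 1 rb S = if S = 1 then 1 else 0 := by
  rw [show (1 : ℕ) = 0 + 1 from rfl, classCard_succ, classCard_zero, classCard_zero]
  unfold sgn3
  have h3 : ∀ T : ZMod 3, T = 0 ∨ T = 1 ∨ T = 2 := by decide
  rcases h3 S with rfl | rfl | rfl <;> cases rb <;> decide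

/-- The correction terms satisfy the same recurrence. -/
theorem classCorr_succ (n : ℕ) (S : ZMod 3) :
    classCorr (n + 1) S = classCorr n (S + 1) + classCorr n (S - 1) := by
  unfold classCorr
  have h3 : ∀ T : ZMod 3, T = 0 ∨ T = 1 ∨ T = 2 := by decide
  rcases h3 S with rfl | rfl | rfl
  · simp only [show ((0 : ZMod 3) = 1) = False by decide, show ((0 : ZMod 3) + 1 = 1) = True by decide,
      show ((0 : ZMod 3) - 1 = 1) = False by decide, if_true, if_false]
    ring
  · simp only [show ((1 : ZMod 3) + 1 = 1) = False by decide,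
      show ((1 : ZMod 3) - 1 = 1) = False by decide, if_true, if_false]
    ring
  · simp only [show ((2 : ZMod 3) = 1) = False by decide, show ((2 : ZMod 3) + 1 = 1) = False by decide,
      show ((2 : ZMod 3) - 1 = 1) = True by decide, if_true, if_false]
    ring

/-- **Class sizes** (all `n ≥ 1`): `6·classCard n rb S = 2ⁿ + classCorr n S`. -/
theorem six_mul_classCard : ∀ (n : ℕ), 1 ≤ n → ∀ (rb : Bool) (S : ZMod 3),
    (6 * classCard n rb S : ℤ) = 2 ^ n + classCorr n S
  | 0, h, _, _ => absurd h (by norm_num)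
  | 1, _, rb, S => by
      rw [classCard_one]
      unfold classCorr
      have h3 : ∀ T : ZMod 3, T = 0 ∨ T = 1 ∨ T = 2 := by decide
      rcases h3 S with rfl | rfl | rfl <;> decide
  | n + 2, _, rb, S => by
      have ih := six_mul_classCard (n + 1) (by omega)
      show (6 * (classCard (n + 1 + 1) rb S : ℕ) : ℤ) = 2 ^ (n + 1 + 1) + classCorr (n + 1 + 1) S
      rw [classCard_succ (n + 1), Nat.cast_add, mul_add, ih, ih, classCorr_succ (n + 1) S]
      -- the two `sigmaSum` shifts are `S + 1` and `S - 1` in some order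
      unfold sgn3
      cases rb
      · simp only [Bool.not_false, if_true, Bool.false_eq_true, if_false, sub_neg_eq_add]
        ring
      · simp only [Bool.not_true, if_true, Bool.false_eq_true, if_false, sub_neg_eq_add]
        ring

/-- **The flip map fails on exactly `(2ⁿ + 2(−1)ⁿ)/6` patterns** (`n ≥ 3`). -/
theorem six_mul_card_zFlip_fail {n : ℕ} (hn : 3 ≤ n) :
    (6 * ((univ.filter fun x : Fin n → Bool => ¬ Rel x (zFlip x)).card : ℤ)) = 2 ^ n + 2 * (-1) ^ n := by
  have hset : (univ.filter fun x : Fin n → Bool => ¬ Rel x (zFlip x)) =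
      univ.filter fun x : Fin n → Bool => reflBit (List.ofFn x) = true ∧ sigmaSum (List.ofFn x) = 0 := by
    ext x
    simp only [mem_filter, mem_univ, true_and, rel_zFlip_iff hn, not_or, Bool.not_eq_false, not_not]
  rw [hset]
  have h := six_mul_classCard n (by omega) true 0
  unfold classCard at h
  rw [h]
  unfold classCorr
  simp

end Summit.QuantumAdvantage.AdviceFreeQNC0
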